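import Mathlib
import HarnessLib
import Summits.QuantumFields.BalabanUV.Beta.LinearizingChange267
import Literature.MathematicalPhysics.QuantumFieldTheory.Balaban1983to89.B13ExpansionOrder
import Literature.MathematicalPhysics.QuantumFieldTheory.Balaban1983to89.B13Ineq140
import Literature.MathematicalPhysics.QuantumFieldTheory.Balaban1983to89.B13PkScaling

/-!
# [Balaban1987RG1] §2 p. 267, the LAST clause «… and D̃^{(2)}(B) = C̃^{(2)}(B)»: the JET of the linearizing correction
# `D̃` in abstract kernel form, and the census inputs of the D̃-family of (2.12) DERIVED from the fixed point

HONEST FRAMING (cell rule).  Discharging `BetaPertH` makes Bałaban's UV stability UNCONDITIONAL — a real constructive-QFT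
result; NOT the continuum limit, NOT the Clay problem.  This module discharges NOTHING of `BetaPertH`: it is the sequel of
`LinearizingChange267` (gen 30: existence, uniqueness, Lipschitz dependence, ANALYTICITY of `D̃`, the solution of
`D = C̃(B − hD)`) and supplies — as abstract functional analysis over `ℂ` — the remaining clause of the same BY-ASSERTION
sentence of [I] p. 267 (cell GAPS G-adv9-20 column (a); terminal leaf (T4)(a) of the row-D4 apex map `BETA/REMAINDER-BETA.md`
§9), `D̃^{(2)} = C̃^{(2)}`, together with the inputs that the (2.12)-census modules `B13ExpansionOrder` ∕ `B13PkOrderEdges` ∕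
`B13PkScaling` take AS HYPOTHESES for `D̃` («analytic and bounded on a ball, D̃0 = 0, DD̃(0) = 0», the cubic bound of
`D̃₃ = D̃ − D̃^{(2)}`, the Jacobian `δD̃∕δB` of term T1) — here THEOREMS about the fixed point.  Bookkeeping-grade; NOT summit
progress.  Unit `b2b-balaban-beta-an4-g31` (owner of `BINDER-OWNERS.md` row D4).

CITATION HEADER (lean-in-tree rule).  [I] = T. Bałaban, *Renormalization group approach to lattice gauge field theories. I.
Generation of effective actions in a small field approximation and a coupling constant renormalization in four dimensions*,
Commun. Math. Phys. **109**, 249–301 (1987) [Balaban1987RG1] (PDF page = journal page − 248).  WHAT IS REPRODUCED — p. 267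
[PDF 19] (render `HOME/b2b-balaban-ref1/pages/1987-cmp109-rg-I-small-field/…-p019-x2.png`, READ AS AN IMAGE by this unit),
verbatim: *"The function D̃(B) is determined by the equation LQ̃B′ + C̃(B′) = LQ̃B − D̃(B) + C̃(B − hD̃(B)) = LQ̃B.  It is easy
to prove, following the proofs in the above mentioned papers, that there exists exactly one solution of this equation, and
that it is an analytic function of B. From this equation we obtain also that D̃(B) has an expansion beginning with quadratic
terms, and D̃^{(2)}(B) = C̃^{(2)}(B)."*; its two printed CONSUMERS — p. 267: *"Next we make the scaling transformation
B = g_kB′. … Terms of the order 0 in g_k are ⟨H₁hC̃^{(2)}(B′), J⟩ − ½G^{(2)}(B′) − ½⟨H₁B′, Δ₁H₁B′⟩. (2.11)"*; p. 268 [PDF 20]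
(render `…-p020-x2.png`, read as an image): *"Denoting the remaining variables by B we have B′ = CB, C is the operator
determined by the configuration V^{(k)}"* and the exponent of (2.12) *"Tr log(I − h((δ∕δB)D̃)(g_kCB)) + log σ(g_kCB −
hD̃(g_kCB)) + (1∕g_k²)⟨H₁hD̃₃(g_kCB), J⟩ − (1∕g_k²)G₃(g_kB) + (1∕g_k²)⟨H₁g_kCB, Δ₁H₁hD̃(g_kCB)⟩ − (1∕g_k²)⟨H₁hD̃(g_kCB),
Δ₁H₁hD̃(g_kCB)⟩ − …"* (census term types T1–T6; `D̃` enters T1, T3, T5, T6; `C̃^{(2)}` enters (2.11)).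

ABSOLUTE RULE (cell).  "No internally-minted statement may enter as a cited fact. Every hypothesis is either kernel-proved in
this package or a verbatim quotation of a PUBLISHED theorem with page reference. The manuscript(s) under audit are NOT citable
for their own disputed steps — they are the thing under adjudication; programme-internal (2001∕route∕tribunal) claims are never
citable."  Nothing is cited as a fact: everything below is PROVED from Mathlib and from ACCEPTED tree modules used BY NAME
(`LinearizingChange267`: `tildeD`, `tildeD_spec`, `tildeD_zero`, `norm_tildeD_sub_le`, `norm_tildeD_le(_sq)`,
`hasFDerivAt_tildeD_zero`, `analyticOnNhd_tildeD`; `B13ExpansionOrder`: `BeginsAt`, `homPart`, `rem`, `beginsAt_two`,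
`bounds_of_jet_two`, `homPart_eq_of_orderGe_sub`, `orderGe_slice_rem`, `homPart_two_eq`; `B11SchwarzRemainder.OrderGe`;
`B13Ineq140.norm_fderiv_apply_le_of_bound` (one Cauchy step); `B13PkScaling.scaled`).

READING (recorded as such; = gen 30's).  `E`, `F` = 𝔤ᶜ-valued functions on the bonds of T^{(k)}, T^{(k+1)} (complex Banach
spaces); `h : F →L[ℂ] E` = the printed «h» («LQ̃h = I»); `C : E → F` = the printed NON-LINEAR PART «C̃» of `Q̃` — whence
`C 0 = 0` and the QUADRATIC ONSET `‖C x‖ ≤ M‖x‖²` on the r-ball (hypothesis `hquad`); `D̃ := LinearizingChange267.tildeD C h ρ σ`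
(THE solution of `D = C(B − hD)` in the σ-ball for `‖B‖ ≤ ρ`, else 0); «X^{(2)}» = `B13ExpansionOrder.homPart X 2` (slice-wise
order-2 part; `= ½D²X(0)(w,w)` for analytic `X`); «D̃₃» = `B13ExpansionOrder.rem D̃ 2 = D̃ − D̃^{(2)}` (DIVERGENCE D-b13.24); in
§4 `K` = the printed OPERATOR «C» of «B′ = CB» (p. 268) and `L` = «⟨H₁h ·, J⟩», abstract bounded linear maps.  Standing data:
gen 30's (`C` λ-Lipschitz on the closed r-ball, `C^ω` on the open r-ball, `ρ + ‖h‖σ < r`, `λr ≤ σ`, `0 ≤ σ`, `0 < ρ`,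
`λ‖h‖ < 1`) plus `hquad` with `0 ≤ M`.

PROVED ([folklore] analysis, constants explicit).  §1 `OrderGe` additive; `hquad` ⟹ `BeginsAt C 2`; ONE CAUCHY STEP `‖DC(z)‖ ≤
4Ms` on `‖z‖ ≤ s`, `2s < r`.  §2 CENSUS INPUTS DERIVED: `D̃` ℂ-differentiable and `≤ σ` on `ball 0 ρ`, `DD̃(0) = 0`, `BeginsAt D̃ 2`,
the pair `‖D̃w‖ ≤ (σ∕ρ²)‖w‖²`, `‖D̃₃w‖ ≤ (2σ∕ρ³)‖w‖³` (`census_bounds_tildeD` = `B13ExpansionOrder.bounds_of_jet_two`, hypotheses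
DISCHARGED); T1's Jacobian `DD̃` analytic with `‖DD̃(B)‖ ≤ κ := λ∕(1 − λ‖h‖)`.  §3 **«D̃^{(2)} = C̃^{(2)}»**: `‖D̃B − CB‖ ≤
4M²‖h‖(1 + ‖h‖κ)³‖B‖³` (mean value + §1), so each slice of `D̃ − C` is `O(t³)` and the order-2 parts coincide
(`homPart_tildeD_two_eq`), also as `D²D̃(0)(w,w) = D²C(0)(w,w)`; the split `D̃ = C^{(2)} + D̃₃`.  §4 CONSUMERS: `X^{(2)}` is
2-homogeneous, so the `C̃^{(2)}`-piece is `g_k`-FREE under `B = g_kB′` (the «order 0 in g_k» of (2.11)) and the D̃-term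
`g_k⁻²⟨H₁hD̃(g_kCB), J⟩` splits EXACTLY into that piece plus term T3 of (2.12) (`scaled_tildeD_term_split`).

NOT CLAIMED.  The DICTIONARY `A, h, C, K ↔ LQ̃, h, C̃, C` of (2.4)∕p. 268 and the UNIFORMITY of `λ, r, M, ρ, σ` in k ∕ volume ∕
background (locality per coarse bond + compactness of the group; G-adv9-20 (b)); the polarised bilinear form of `X^{(2)}` off
the diagonal; column (b) (s-decoupling∕localisation of T3, T5, T6); [15] Sect. C ∕ [14] Sect. E; NOT summit progress.
-/

namespace Summit.QuantumFields.BalabanUV.Beta.LinearizingChange267Jet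

open Metric Set Filter
open scoped NNReal Topology ContDiff
open Summit.QuantumFields.BalabanUV.Beta.LinearizingChange267
open Literature.MathematicalPhysics.QuantumFieldTheory.Balaban1983to89
open Literature.MathematicalPhysics.QuantumFieldTheory.Balaban1983to89.B11SchwarzRemainder (OrderGe)
open Literature.MathematicalPhysics.QuantumFieldTheory.Balaban1983to89.B13ExpansionOrder (slice BeginsAt homPart rem
  beginsAt_two bounds_of_jet_two homPart_eq_of_orderGe_sub orderGe_slice_rem homPart_two_eq homPart_zero_right)

noncomputable section

variable {E : Type*} [NormedAddCommGroup E] [NormedSpace ℂ E]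
  {F : Type*} [NormedAddCommGroup F] [NormedSpace ℂ F]

/-! ## §1 Generalities: additivity of `OrderGe`, quadratic onset from a quadratic bound, one Cauchy step -/

omit [NormedSpace ℂ F] in
/-- `OrderGe` is additive. [folklore] -/
theorem orderGe_add {f g : ℂ → F} {n : ℕ} (hf : OrderGe f n) (hg : OrderGe g n) :
    OrderGe (fun t => f t + g t) n := by
  obtain ⟨⟨C₁, h₁⟩, ⟨C₂, h₂⟩⟩ := And.intro hf hg
  refine ⟨C₁ + C₂, ?_⟩
  filter_upwards [h₁, h₂] with t ht₁ ht₂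
  calc ‖f t + g t‖ ≤ ‖f t‖ + ‖g t‖ := norm_add_le _ _
    _ ≤ C₁ * ‖t‖ ^ n + C₂ * ‖t‖ ^ n := add_le_add ht₁ ht₂
    _ = (C₁ + C₂) * ‖t‖ ^ n := by ring

omit [NormedSpace ℂ F] in
/-- A quadratic bound `‖C x‖ ≤ M‖x‖²` on the closed r-ball (`0 < r`) gives quadratic onset `BeginsAt C 2`. [folklore] -/
theorem beginsAt_two_of_sq_bound {C : E → F} {r M : ℝ} (hr : 0 < r)
    (hquad : ∀ x ∈ closedBall (0 : E) r, ‖C x‖ ≤ M * ‖x‖ ^ 2) : BeginsAt C 2 := by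
  intro w
  refine OrderGe.of_bound_on_ball (r := r / (‖w‖ + 1)) (C := M * ‖w‖ ^ 2) (div_pos hr (by positivity)) ?_
  intro t ht
  rw [mem_ball_zero_iff, lt_div_iff₀ (by positivity)] at ht
  have htw : t • w ∈ closedBall (0 : E) r := by
    rw [mem_closedBall_zero_iff, norm_smul]
    have h1 : ‖t‖ * ‖w‖ ≤ ‖t‖ * (‖w‖ + 1) := by gcongr; linarith
    linarith
  calc ‖slice C w t‖ = ‖C (t • w)‖ := rfl
    _ ≤ M * ‖t • w‖ ^ 2 := hquad _ htw
    _ = M * ‖w‖ ^ 2 * ‖t‖ ^ 2 := by rw [norm_smul]; ring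

/-- ONE CAUCHY STEP: `C` ℂ-differentiable on the open r-ball with `‖C x‖ ≤ M‖x‖²` on the closed one; for `0 < s`, `2s < r`:
`‖DC(z)‖ ≤ 4Ms` whenever `‖z‖ ≤ s` (shells `s < 2s`, sup `M(2s)²`; `B13Ineq140.norm_fderiv_apply_le_of_bound`). [folklore] -/
theorem norm_fderiv_le_of_sq_bound {C : E → F} {r M s : ℝ} (hM : 0 ≤ M)
    (hdiff : DifferentiableOn ℂ C (ball (0 : E) r))
    (hquad : ∀ x ∈ closedBall (0 : E) r, ‖C x‖ ≤ M * ‖x‖ ^ 2)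
    (hs : 0 < s) (h2s : 2 * s < r) {z : E} (hz : ‖z‖ ≤ s) :
    ‖fderiv ℂ C z‖ ≤ 4 * M * s := by
  have hB : ∀ x : E, ‖x‖ ≤ 2 * s → ‖C x‖ ≤ M * (2 * s) ^ 2 := by
    intro x hx
    have hxr : x ∈ closedBall (0 : E) r := mem_closedBall_zero_iff.mpr (hx.trans h2s.le)
    calc ‖C x‖ ≤ M * ‖x‖ ^ 2 := hquad x hxr
      _ ≤ M * (2 * s) ^ 2 := by gcongr
  refine ContinuousLinearMap.opNorm_le_bound _ (by positivity) fun v => ?_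
  have h := B13Ineq140.norm_fderiv_apply_le_of_bound hdiff h2s (by linarith : s < 2 * s) hB hz v
  have hs0 := hs.ne'
  calc ‖fderiv ℂ C z v‖ ≤ M * (2 * s) ^ 2 / (2 * s - s) * ‖v‖ := h
    _ = 4 * M * s * ‖v‖ := by field_simp; ring

/-! ## §2 The census inputs for `D̃`, DERIVED from the fixed point -/

section Derived

variable {C : E → F} {h : F →L[ℂ] E} {lam : ℝ≥0} {r ρ σ : ℝ}

/-- A `C^ω` map on the open r-ball is analytic there (over `ℂ`). [folklore] -/
theorem analyticOnNhd_of_contDiffAt (hCω : ∀ x ∈ ball (0 : E) r, ContDiffAt ℂ ω C x) :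
    AnalyticOnNhd ℂ C (ball (0 : E) r) :=
  fun x hx => (hCω x hx).analyticAt

variable [CompleteSpace F]

/-- `D̃` is bounded by `σ` on the open ρ-ball (`tildeD_spec`). [folklore] -/
theorem norm_tildeD_le_sigma (hC0 : C 0 = 0) (hLip : LipschitzOnWith lam C (closedBall (0 : E) r))
    (hr : ρ + ‖h‖ * σ < r) (hσ : (lam : ℝ) * r ≤ σ) (hσ0 : 0 ≤ σ) (hq : (lam : ℝ) * ‖h‖ < 1) :
    ∀ z ∈ ball (0 : E) ρ, ‖tildeD C h ρ σ z‖ ≤ σ :=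
  fun _ hz => mem_closedBall_zero_iff.mp (tildeD_spec hC0 hLip hr.le hσ hσ0 hq (ball_subset_closedBall hz)).1

/-- `DD̃(0) = 0` as an equation for `fderiv` (`LinearizingChange267.hasFDerivAt_tildeD_zero`). [folklore] -/
theorem fderiv_tildeD_zero (hC0 : C 0 = 0) (hLip : LipschitzOnWith lam C (closedBall (0 : E) r))
    (hr : ρ + ‖h‖ * σ < r) (hσ : (lam : ℝ) * r ≤ σ) (hσ0 : 0 ≤ σ) (hρ0 : 0 < ρ) (hq : (lam : ℝ) * ‖h‖ < 1)
    {M : ℝ} (hM : 0 ≤ M) (hquad : ∀ x ∈ closedBall (0 : E) r, ‖C x‖ ≤ M * ‖x‖ ^ 2) :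
    fderiv ℂ (tildeD C h ρ σ) 0 = 0 :=
  (hasFDerivAt_tildeD_zero hC0 hLip hr.le hσ hσ0 hρ0 hq hM hquad).fderiv

/-- `D̃` is κ-Lipschitz on the closed ρ-ball, `κ = λ∕(1 − λ‖h‖)` (`LinearizingChange267.norm_tildeD_sub_le`, repackaged). [folklore] -/
theorem lipschitzOnWith_tildeD (hC0 : C 0 = 0) (hLip : LipschitzOnWith lam C (closedBall (0 : E) r))
    (hr : ρ + ‖h‖ * σ < r) (hσ : (lam : ℝ) * r ≤ σ) (hσ0 : 0 ≤ σ) (hq : (lam : ℝ) * ‖h‖ < 1) :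
    LipschitzOnWith (Real.toNNReal (lam / (1 - lam * ‖h‖))) (tildeD C h ρ σ) (closedBall (0 : E) ρ) := by
  refine LipschitzOnWith.of_dist_le_mul fun B₁ hB₁ B₂ hB₂ => ?_
  rw [dist_eq_norm, dist_eq_norm]
  have hκ0 : 0 ≤ (lam : ℝ) / (1 - lam * ‖h‖) := div_nonneg lam.coe_nonneg (by linarith)
  rw [Real.coe_toNNReal _ hκ0]
  exact norm_tildeD_sub_le hC0 hLip hr.le hσ hσ0 hq hB₁ hB₂

/-- … with `‖DD̃(B)‖ ≤ κ = λ∕(1 − λ‖h‖)` on the open ρ-ball (`norm_fderiv_le_of_lipschitzOn`). [folklore] -/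
theorem norm_fderiv_tildeD_le (hC0 : C 0 = 0) (hLip : LipschitzOnWith lam C (closedBall (0 : E) r))
    (hr : ρ + ‖h‖ * σ < r) (hσ : (lam : ℝ) * r ≤ σ) (hσ0 : 0 ≤ σ) (hq : (lam : ℝ) * ‖h‖ < 1)
    {B : E} (hB : B ∈ ball (0 : E) ρ) :
    ‖fderiv ℂ (tildeD C h ρ σ) B‖ ≤ lam / (1 - lam * ‖h‖) := by
  have hnhds : closedBall (0 : E) ρ ∈ 𝓝 B := mem_of_superset (isOpen_ball.mem_nhds hB) ball_subset_closedBall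
  have hκ0 : 0 ≤ (lam : ℝ) / (1 - lam * ‖h‖) := div_nonneg lam.coe_nonneg (by linarith)
  have h1 := norm_fderiv_le_of_lipschitzOn ℂ hnhds (lipschitzOnWith_tildeD hC0 hLip hr hσ hσ0 hq)
  rwa [Real.coe_toNNReal _ hκ0] at h1

/-- `D̃` is ℂ-differentiable on the open ρ-ball (it is analytic there, `LinearizingChange267.analyticOnNhd_tildeD`). [folklore] -/
theorem differentiableOn_tildeD [CompleteSpace E] (hC0 : C 0 = 0) (hLip : LipschitzOnWith lam C (closedBall (0 : E) r))
    (hr : ρ + ‖h‖ * σ < r) (hσ : (lam : ℝ) * r ≤ σ) (hσ0 : 0 ≤ σ) (hq : (lam : ℝ) * ‖h‖ < 1)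
    (hCω : ∀ x ∈ ball (0 : E) r, ContDiffAt ℂ ω C x) :
    DifferentiableOn ℂ (tildeD C h ρ σ) (ball (0 : E) ρ) :=
  (analyticOnNhd_tildeD hC0 hLip hr hσ hσ0 hq hCω).differentiableOn

/-- **«D̃(B) HAS AN EXPANSION BEGINNING WITH QUADRATIC TERMS»** in the census reading `BeginsAt D̃ 2` (every slice
`t ↦ D̃(t•w)` is `O(t²)`), DERIVED from `D̃0 = 0`, `DD̃(0) = 0` (`B13ExpansionOrder.beginsAt_two`). [cite: Balaban1987RG1, §2 p.267] -/
theorem beginsAt_two_tildeD [CompleteSpace E] (hC0 : C 0 = 0) (hLip : LipschitzOnWith lam C (closedBall (0 : E) r)) (hr : ρ + ‖h‖ * σ < r)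
    (hσ : (lam : ℝ) * r ≤ σ) (hσ0 : 0 ≤ σ) (hρ0 : 0 < ρ) (hq : (lam : ℝ) * ‖h‖ < 1) (hCω : ∀ x ∈ ball (0 : E) r, ContDiffAt ℂ ω C x)
    {M : ℝ} (hM : 0 ≤ M) (hquad : ∀ x ∈ closedBall (0 : E) r, ‖C x‖ ≤ M * ‖x‖ ^ 2) :
    BeginsAt (tildeD C h ρ σ) 2 :=
  beginsAt_two hρ0 (differentiableOn_tildeD hC0 hLip hr hσ hσ0 hq hCω)
    (tildeD_zero hC0 hLip hr.le hσ hσ0 hρ0.le hq) (fderiv_tildeD_zero hC0 hLip hr hσ hσ0 hρ0 hq hM hquad)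

/-- **THE CENSUS PAIR FOR `D̃`, hypotheses DISCHARGED** (`B13ExpansionOrder.bounds_of_jet_two`, there under INPUTS «`D`
differentiable and `≤ M` on `ball 0 R`, `D 0 = 0`, `DD(0) = 0`» by reference to the print — here theorems about the fixed
point): on the open ρ-ball `‖D̃w‖ ≤ (σ∕ρ²)‖w‖²` (T5∕T6 input of `B13PkScaling.cubic_bilin_*`) and `‖D̃₃w‖ ≤ (2σ∕ρ³)‖w‖³`,
`D̃₃ = rem D̃ 2` (T3 input of `B13PkScaling.pow_bound_clm_comp`). [cite: Balaban1987RG1, (2.12) p.268] -/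
theorem census_bounds_tildeD [CompleteSpace E] (hC0 : C 0 = 0) (hLip : LipschitzOnWith lam C (closedBall (0 : E) r)) (hr : ρ + ‖h‖ * σ < r)
    (hσ : (lam : ℝ) * r ≤ σ) (hσ0 : 0 ≤ σ) (hρ0 : 0 < ρ) (hq : (lam : ℝ) * ‖h‖ < 1) (hCω : ∀ x ∈ ball (0 : E) r, ContDiffAt ℂ ω C x)
    {M : ℝ} (hM : 0 ≤ M) (hquad : ∀ x ∈ closedBall (0 : E) r, ‖C x‖ ≤ M * ‖x‖ ^ 2) :
    (∀ w ∈ ball (0 : E) ρ, ‖tildeD C h ρ σ w‖ ≤ σ / ρ ^ 2 * ‖w‖ ^ 2) ∧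
      ∀ w ∈ ball (0 : E) ρ, ‖rem (tildeD C h ρ σ) 2 w‖ ≤ 2 * σ / ρ ^ 3 * ‖w‖ ^ 3 :=
  bounds_of_jet_two hρ0 (differentiableOn_tildeD hC0 hLip hr hσ hσ0 hq hCω)
    (norm_tildeD_le_sigma hC0 hLip hr hσ hσ0 hq) (tildeD_zero hC0 hLip hr.le hσ hσ0 hρ0.le hq)
    (fderiv_tildeD_zero hC0 hLip hr hσ hσ0 hρ0 hq hM hquad)

/-- T1's Jacobian «(δ∕δB)D̃» of (2.12): `B ↦ DD̃(B)` is analytic on the open ρ-ball. [cite: Balaban1987RG1, (2.12) p.268] -/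
theorem analyticOnNhd_fderiv_tildeD [CompleteSpace E] (hC0 : C 0 = 0) (hLip : LipschitzOnWith lam C (closedBall (0 : E) r))
    (hr : ρ + ‖h‖ * σ < r) (hσ : (lam : ℝ) * r ≤ σ) (hσ0 : 0 ≤ σ) (hq : (lam : ℝ) * ‖h‖ < 1)
    (hCω : ∀ x ∈ ball (0 : E) r, ContDiffAt ℂ ω C x) :
    AnalyticOnNhd ℂ (fderiv ℂ (tildeD C h ρ σ)) (ball (0 : E) ρ) :=
  (analyticOnNhd_tildeD hC0 hLip hr hσ hσ0 hq hCω).fderiv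

end Derived

/-! ## §3 «D̃^{(2)}(B) = C̃^{(2)}(B)» -/

section Jet

variable {C : E → F} {h : F →L[ℂ] E} {lam : ℝ≥0} {r ρ σ : ℝ}
variable [CompleteSpace F]

/-- THE CUBIC PROXIMITY OF `D̃` AND `C`: for `‖B‖ ≤ ρ`, `2(1 + ‖h‖κ)‖B‖ < r` (`κ = λ∕(1 − λ‖h‖)`): `‖D̃B − C B‖ =
‖C(B − hD̃B) − C(B)‖ ≤ 4M²‖h‖(1 + ‖h‖κ)³‖B‖³` — mean value inequality on the ball of radius `s = (1 + ‖h‖κ)‖B‖ ∋ B, B − hD̃B`,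
where `‖DC‖ ≤ 4Ms` (§1), times `‖hD̃B‖ ≤ ‖h‖·M(1 + ‖h‖κ)²‖B‖²` (`LinearizingChange267.norm_tildeD_le_sq`). [folklore] -/
theorem norm_tildeD_sub_apply_le (hC0 : C 0 = 0) (hLip : LipschitzOnWith lam C (closedBall (0 : E) r)) (hr : ρ + ‖h‖ * σ < r)
    (hσ : (lam : ℝ) * r ≤ σ) (hσ0 : 0 ≤ σ) (hρ0 : 0 < ρ) (hq : (lam : ℝ) * ‖h‖ < 1) (hCω : ∀ x ∈ ball (0 : E) r, ContDiffAt ℂ ω C x)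
    {M : ℝ} (hM : 0 ≤ M) (hquad : ∀ x ∈ closedBall (0 : E) r, ‖C x‖ ≤ M * ‖x‖ ^ 2)
    {B : E} (hB : B ∈ closedBall (0 : E) ρ) (hBr : 2 * ((1 + ‖h‖ * (lam / (1 - lam * ‖h‖))) * ‖B‖) < r) :
    ‖tildeD C h ρ σ B - C B‖ ≤
      4 * M ^ 2 * ‖h‖ * (1 + ‖h‖ * (lam / (1 - lam * ‖h‖))) ^ 3 * ‖B‖ ^ 3 := by
  set κ : ℝ := lam / (1 - lam * ‖h‖) with hκ
  have hκ0 : 0 ≤ κ := div_nonneg lam.coe_nonneg (by linarith)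
  set D := tildeD C h ρ σ B with hD
  obtain ⟨hDs, hDe⟩ := tildeD_spec hC0 hLip hr.le hσ hσ0 hq hB
  have hDq : ‖D‖ ≤ M * (1 + ‖h‖ * κ) ^ 2 * ‖B‖ ^ 2 := norm_tildeD_le_sq hC0 hLip hr.le hσ hσ0 hρ0.le hq hM hquad hB
  have hDκ : ‖D‖ ≤ κ * ‖B‖ := norm_tildeD_le hC0 hLip hr.le hσ hσ0 hρ0.le hq hB
  set s : ℝ := (1 + ‖h‖ * κ) * ‖B‖ with hs
  by_cases hB0 : B = 0
  · have hD0 : D = 0 := by rw [hD, hB0]; exact tildeD_zero hC0 hLip hr.le hσ hσ0 hρ0.le hq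
    rw [hD0, hB0, hC0, sub_zero, norm_zero, norm_zero]
    positivity
  have hBpos : 0 < ‖B‖ := norm_pos_iff.mpr hB0
  have hspos : 0 < s := by positivity
  have hx₀ : B ∈ closedBall (0 : E) s := by
    rw [mem_closedBall_zero_iff, hs]; nlinarith [mul_nonneg (mul_nonneg (norm_nonneg h) hκ0) (norm_nonneg B)]
  have hx₁ : B - h D ∈ closedBall (0 : E) s := by
    rw [mem_closedBall_zero_iff, hs]
    calc ‖B - h D‖ ≤ ‖B‖ + ‖h‖ * ‖D‖ := (norm_sub_le _ _).trans (by gcongr; exact h.le_opNorm _)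
      _ ≤ ‖B‖ + ‖h‖ * (κ * ‖B‖) := by gcongr
      _ = (1 + ‖h‖ * κ) * ‖B‖ := by ring
  have hdiff := (analyticOnNhd_of_contDiffAt hCω).differentiableOn
  have hder : ∀ x ∈ closedBall (0 : E) s, ‖fderiv ℂ C x‖ ≤ 4 * M * s := fun x hx =>
    norm_fderiv_le_of_sq_bound hM hdiff hquad hspos (by rw [hs]; exact hBr) (mem_closedBall_zero_iff.mp hx)
  have hdiffAt : ∀ x ∈ closedBall (0 : E) s, DifferentiableAt ℂ C x := fun x hx =>
    hdiff.differentiableAt (isOpen_ball.mem_nhds (mem_ball_zero_iff.mpr (by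
      have := mem_closedBall_zero_iff.mp hx; linarith)))
  have hmv := (convex_closedBall (0 : E) s).norm_image_sub_le_of_norm_fderiv_le hdiffAt hder hx₀ hx₁
  have harg : ‖B - h D - B‖ ≤ ‖h‖ * ‖D‖ := by
    rw [show B - h D - B = -(h D) by abel, norm_neg]; exact h.le_opNorm _
  have hDe' : D = C (B - h D) := by rw [hD]; exact hDe
  rw [hDe']
  calc ‖C (B - h D) - C B‖ ≤ 4 * M * s * ‖B - h D - B‖ := hmv
    _ ≤ 4 * M * s * (‖h‖ * ‖D‖) := by gcongr
    _ ≤ 4 * M * s * (‖h‖ * (M * (1 + ‖h‖ * κ) ^ 2 * ‖B‖ ^ 2)) := by gcongr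
    _ = 4 * M ^ 2 * ‖h‖ * (1 + ‖h‖ * κ) ^ 3 * ‖B‖ ^ 3 := by rw [hs]; ring

/-- Hence every complex slice of `D̃ − C` is `O(t³)`. [folklore] -/
theorem orderGe_three_slice_tildeD_sub (hC0 : C 0 = 0) (hLip : LipschitzOnWith lam C (closedBall (0 : E) r)) (hr : ρ + ‖h‖ * σ < r)
    (hσ : (lam : ℝ) * r ≤ σ) (hσ0 : 0 ≤ σ) (hρ0 : 0 < ρ) (hq : (lam : ℝ) * ‖h‖ < 1) (hCω : ∀ x ∈ ball (0 : E) r, ContDiffAt ℂ ω C x)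
    {M : ℝ} (hM : 0 ≤ M) (hquad : ∀ x ∈ closedBall (0 : E) r, ‖C x‖ ≤ M * ‖x‖ ^ 2) (w : E) :
    OrderGe (fun t : ℂ => tildeD C h ρ σ (t • w) - C (t • w)) 3 := by
  set κ : ℝ := lam / (1 - lam * ‖h‖) with hκ
  have hκ0 : 0 ≤ κ := div_nonneg lam.coe_nonneg (by linarith)
  have hr0 : 0 < r := by nlinarith [mul_nonneg (norm_nonneg h) hσ0]
  set a : ℝ := 2 * (1 + ‖h‖ * κ) * (‖w‖ + 1) with ha
  have hapos : 0 < a := by positivity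
  set δ : ℝ := min (ρ / (‖w‖ + 1)) (r / a) with hδ
  have hδpos : 0 < δ := lt_min (div_pos hρ0 (by positivity)) (div_pos hr0 hapos)
  refine OrderGe.of_bound_on_ball (r := δ) (C := 4 * M ^ 2 * ‖h‖ * (1 + ‖h‖ * κ) ^ 3 * ‖w‖ ^ 3) hδpos ?_
  intro t ht
  rw [mem_ball_zero_iff] at ht
  obtain ⟨ht1, ht2⟩ := lt_min_iff.mp ht
  have hw1 : ‖t • w‖ ≤ ‖t‖ * (‖w‖ + 1) := by rw [norm_smul]; gcongr; linarith
  have hB : t • w ∈ closedBall (0 : E) ρ := by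
    rw [mem_closedBall_zero_iff]; rw [lt_div_iff₀ (by positivity)] at ht1; linarith
  have hBr : 2 * ((1 + ‖h‖ * κ) * ‖t • w‖) < r := by
    rw [lt_div_iff₀ hapos, ha] at ht2
    calc 2 * ((1 + ‖h‖ * κ) * ‖t • w‖) ≤ 2 * ((1 + ‖h‖ * κ) * (‖t‖ * (‖w‖ + 1))) := by gcongr
      _ = ‖t‖ * (2 * (1 + ‖h‖ * κ) * (‖w‖ + 1)) := by ring
      _ < r := ht2
  have hmain := norm_tildeD_sub_apply_le hC0 hLip hr hσ hσ0 hρ0 hq hCω hM hquad hB hBr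
  calc ‖tildeD C h ρ σ (t • w) - C (t • w)‖
        ≤ 4 * M ^ 2 * ‖h‖ * (1 + ‖h‖ * κ) ^ 3 * ‖t • w‖ ^ 3 := hmain
    _ = 4 * M ^ 2 * ‖h‖ * (1 + ‖h‖ * κ) ^ 3 * ‖w‖ ^ 3 * ‖t‖ ^ 3 := by rw [norm_smul]; ring

variable [CompleteSpace E]

/-- **«D̃^{(2)}(B) = C̃^{(2)}(B)»** ([I] p. 267, the last clause): the order-2 homogeneous parts of `D̃` and `C` coincide —
the slice `t ↦ D̃(t•w) − t²·C^{(2)}(w)` is `O(t³)` (cubic proximity + `B13ExpansionOrder.orderGe_slice_rem` for `C`) and the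
leading coefficient of an `O(t²)` slice is unique (`homPart_eq_of_orderGe_sub`). [cite: Balaban1987RG1, §2 p.267] -/
theorem homPart_tildeD_two_eq (hC0 : C 0 = 0) (hLip : LipschitzOnWith lam C (closedBall (0 : E) r)) (hr : ρ + ‖h‖ * σ < r)
    (hσ : (lam : ℝ) * r ≤ σ) (hσ0 : 0 ≤ σ) (hρ0 : 0 < ρ) (hq : (lam : ℝ) * ‖h‖ < 1) (hCω : ∀ x ∈ ball (0 : E) r, ContDiffAt ℂ ω C x)
    {M : ℝ} (hM : 0 ≤ M) (hquad : ∀ x ∈ closedBall (0 : E) r, ‖C x‖ ≤ M * ‖x‖ ^ 2) (w : E) :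
    homPart (tildeD C h ρ σ) 2 w = homPart C 2 w := by
  have hr0 : 0 < r := by nlinarith [mul_nonneg (norm_nonneg h) hσ0]
  by_cases hw : w = 0
  · subst hw
    rw [homPart_zero_right (tildeD_zero hC0 hLip hr.le hσ hσ0 hρ0.le hq) 1, homPart_zero_right hC0 1]
  have hdiff := (analyticOnNhd_of_contDiffAt hCω).differentiableOn
  have hCM : ∀ z ∈ ball (0 : E) r, ‖C z‖ ≤ M * r ^ 2 := by
    intro z hz
    have hz' := mem_ball_zero_iff.mp hz
    exact (hquad z (ball_subset_closedBall hz)).trans (by gcongr)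
  have hCB : BeginsAt C 2 := beginsAt_two_of_sq_bound hr0 hquad
  have hrem : OrderGe (fun t : ℂ => tildeD C h ρ σ (t • w) - t ^ 2 • homPart C 2 w) 3 := by
    have h1 := orderGe_three_slice_tildeD_sub hC0 hLip hr hσ hσ0 hρ0 hq hCω hM hquad w
    have h2 := orderGe_slice_rem hr0 hdiff hCM hCB w
    have h3 := orderGe_add h1 h2
    refine (show (fun t : ℂ => tildeD C h ρ σ (t • w) - t ^ 2 • homPart C 2 w) =
        fun t => (tildeD C h ρ σ (t • w) - C (t • w)) + (C (t • w) - t ^ 2 • homPart C 2 w) from ?_) ▸ h3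
    funext t; abel
  exact homPart_eq_of_orderGe_sub hρ0 (differentiableOn_tildeD hC0 hLip hr hσ hσ0 hq hCω)
    (norm_tildeD_le_sigma hC0 hLip hr hσ hσ0 hq) (beginsAt_two_tildeD hC0 hLip hr hσ hσ0 hρ0 hq hCω hM hquad) hw hrem

/-- The same in second-derivative form: `D²D̃(0)(w,w) = D²C(0)(w,w)` for every direction `w`
(`B13ExpansionOrder.homPart_two_eq` on both sides). [cite: Balaban1987RG1, §2 p.267] -/
theorem fderiv_fderiv_tildeD_zero_eq (hC0 : C 0 = 0) (hLip : LipschitzOnWith lam C (closedBall (0 : E) r)) (hr : ρ + ‖h‖ * σ < r)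
    (hσ : (lam : ℝ) * r ≤ σ) (hσ0 : 0 ≤ σ) (hρ0 : 0 < ρ) (hq : (lam : ℝ) * ‖h‖ < 1) (hCω : ∀ x ∈ ball (0 : E) r, ContDiffAt ℂ ω C x)
    {M : ℝ} (hM : 0 ≤ M) (hquad : ∀ x ∈ closedBall (0 : E) r, ‖C x‖ ≤ M * ‖x‖ ^ 2) (w : E) :
    fderiv ℂ (fun z => fderiv ℂ (tildeD C h ρ σ) z w) 0 w = fderiv ℂ (fun z => fderiv ℂ C z w) 0 w := by
  have hr0 : 0 < r := by nlinarith [mul_nonneg (norm_nonneg h) hσ0]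
  have h1 := homPart_two_eq hρ0 (analyticOnNhd_tildeD hC0 hLip hr hσ hσ0 hq hCω) w
  have h2 := homPart_two_eq hr0 (analyticOnNhd_of_contDiffAt hCω) w
  have h3 := homPart_tildeD_two_eq hC0 hLip hr hσ hσ0 hρ0 hq hCω hM hquad w
  rw [h1, h2] at h3
  exact smul_right_injective F (inv_ne_zero (two_ne_zero (α := ℂ))) h3

/-- THE SPLIT `D̃ = C^{(2)} + D̃₃`, `D̃₃ = rem D̃ 2 = D̃ − D̃^{(2)}` — the form in which p. 267's identity is CONSUMED (the
`C̃^{(2)}`-piece goes to (2.11), `D̃₃` to term T3 of (2.12)); an identity on all of `E`. [cite: Balaban1987RG1, (2.11)–(2.12) pp.267–268] -/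
theorem tildeD_eq_homPart_add_rem (hC0 : C 0 = 0) (hLip : LipschitzOnWith lam C (closedBall (0 : E) r)) (hr : ρ + ‖h‖ * σ < r)
    (hσ : (lam : ℝ) * r ≤ σ) (hσ0 : 0 ≤ σ) (hρ0 : 0 < ρ) (hq : (lam : ℝ) * ‖h‖ < 1) (hCω : ∀ x ∈ ball (0 : E) r, ContDiffAt ℂ ω C x)
    {M : ℝ} (hM : 0 ≤ M) (hquad : ∀ x ∈ closedBall (0 : E) r, ‖C x‖ ≤ M * ‖x‖ ^ 2) (w : E) :
    tildeD C h ρ σ w = homPart C 2 w + rem (tildeD C h ρ σ) 2 w := by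
  rw [← homPart_tildeD_two_eq hC0 hLip hr hσ hσ0 hρ0 hq hCω hM hquad w]
  simp [rem]

end Jet

/-! ## §4 The two printed consumers: 2-homogeneity of `X^{(2)}`, the order-0 term of (2.11), the D̃-line of (2.12) -/

section Consumers

variable [CompleteSpace F]

/-- The order-2 part of an analytic map is 2-HOMOGENEOUS, `X^{(2)}(c•w) = c²·X^{(2)}(w)` (via `homPart_two_eq`). [folklore] -/
theorem homPart_two_smul {X : E → F} {R : ℝ} (hR : 0 < R) (hX : AnalyticOnNhd ℂ X (ball (0 : E) R)) (c : ℂ) (w : E) :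
    homPart X 2 (c • w) = c ^ 2 • homPart X 2 w := by
  rw [homPart_two_eq hR hX (c • w), homPart_two_eq hR hX w]
  have hfun : (fun z => fderiv ℂ X z (c • w)) = fun z => c • fderiv ℂ X z w := by
    funext z; rw [map_smul]
  have hdiff : DifferentiableAt ℂ (fun z => fderiv ℂ X z w) 0 := by
    have hA : AnalyticAt ℂ (fderiv ℂ X) 0 := hX.fderiv 0 (mem_ball_self hR)
    exact (hA.differentiableAt).clm_apply (differentiableAt_const w)
  rw [hfun, fderiv_fun_const_smul hdiff, FunLike.coe_smul, Pi.smul_apply, map_smul, smul_smul, smul_smul, smul_smul]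
  congr 1
  ring

variable {E' : Type*} [NormedAddCommGroup E'] [NormedSpace ℂ E']
  {G : Type*} [NormedAddCommGroup G] [NormedSpace ℂ G]

/-- **«TERMS OF THE ORDER 0 IN g_k»** ((2.11), the piece `⟨H₁hC̃^{(2)}(B′), J⟩`): under `B = g_kB′` a term `L(X^{(2)}(KB))`
(`L` = «⟨H₁h ·, J⟩», `K` = «C» linear) is `g_k`-FREE: `scaled g (L ∘ X^{(2)} ∘ K) = L ∘ X^{(2)} ∘ K`. [cite: Balaban1987RG1, (2.11) p.267] -/
theorem scaled_homPart_two {X : E → F} {R : ℝ} (hR : 0 < R) (hX : AnalyticOnNhd ℂ X (ball (0 : E) R))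
    (L : F →L[ℂ] G) (K : E' →L[ℂ] E) {g : ℂ} (hg : g ≠ 0) :
    B13PkScaling.scaled g (fun B => L (homPart X 2 (K B))) = fun B => L (homPart X 2 (K B)) := by
  funext B
  simp only [B13PkScaling.scaled]
  rw [map_smul, homPart_two_smul hR hX g (K B), map_smul, smul_smul, inv_mul_cancel₀ (pow_ne_zero 2 hg), one_smul]

/-- **THE D̃-LINE OF (2.12)**: the scaled D̃-term splits EXACTLY into the `g_k`-free `C̃^{(2)}`-piece of (2.11) and term
T3 of (2.12): `g⁻²·L(D̃(g·KB)) = L(C^{(2)}(KB)) + g⁻²·L(D̃₃(g·KB))` for every `B`, `g ≠ 0` (the one net power of `g_k` in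
the second piece is `B13PkScaling.cubic_scaled` with §2's constant). [cite: Balaban1987RG1, (2.11)–(2.12) pp.267–268] -/
theorem scaled_tildeD_term_split [CompleteSpace E] {C : E → F} {h : F →L[ℂ] E} {lam : ℝ≥0} {r ρ σ : ℝ}
    (hC0 : C 0 = 0) (hLip : LipschitzOnWith lam C (closedBall (0 : E) r)) (hr : ρ + ‖h‖ * σ < r)
    (hσ : (lam : ℝ) * r ≤ σ) (hσ0 : 0 ≤ σ) (hρ0 : 0 < ρ) (hq : (lam : ℝ) * ‖h‖ < 1) (hCω : ∀ x ∈ ball (0 : E) r, ContDiffAt ℂ ω C x)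
    {M : ℝ} (hM : 0 ≤ M) (hquad : ∀ x ∈ closedBall (0 : E) r, ‖C x‖ ≤ M * ‖x‖ ^ 2)
    (L : F →L[ℂ] G) (K : E' →L[ℂ] E) {g : ℂ} (hg : g ≠ 0) (B : E') :
    B13PkScaling.scaled g (fun B => L (tildeD C h ρ σ (K B))) B =
      L (homPart C 2 (K B)) + B13PkScaling.scaled g (fun B => L (rem (tildeD C h ρ σ) 2 (K B))) B := by
  have hr0 : 0 < r := by nlinarith [mul_nonneg (norm_nonneg h) hσ0]
  have hsplit := tildeD_eq_homPart_add_rem hC0 hLip hr hσ hσ0 hρ0 hq hCω hM hquad (K (g • B))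
  have h0 := congrFun (scaled_homPart_two hr0 (analyticOnNhd_of_contDiffAt hCω) L K hg) B
  simp only [B13PkScaling.scaled] at h0 ⊢
  rw [hsplit, map_add, smul_add, h0]

end Consumers

end

end Summit.QuantumFields.BalabanUV.Beta.LinearizingChange267Jet
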